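import Summits.QuantumFields.BalabanUV.T4Continuum.Support.NE7ExpansionRemainderFlat
import Summits.QuantumFields.BalabanUV.T4Continuum.Support.NE7FirstVariationLocality
import Summits.QuantumFields.BalabanUV.T4Continuum.Support.NE7QbarLocality
import Summits.QuantumFields.BalabanUV.T4Continuum.Support.NE7ApeFlatSkeleton
import Summits.QuantumFields.BalabanUV.T4Continuum.Support.NE3SmoothRightInverseW
import HarnessLib

/-!
# NE7StraightDefectLetters — THREE LETTERS OF THE v4 DEFECT ASSEMBLY: (a) the SUP DENSITY of the first variation at `e^{A}`, `|dAction_{e^A} Y| ≤ (ρ + 4#Plane·α₁)‖Y‖₁`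
# (EXP + the flat Hessian against the sup of the flat curl of `A`); (b) the WEIGHTED CONFIGURATION LOCALITY of `dAction`, `dAction_V(g·Y) = dAction_{V′}(g·Y)` when
# `V, V′` agree on the bonds of every plaquette at whose three base corners `g` does not vanish identically; (c) the POINTWISE COMPARISON `‖Q̄_{U′}(g·Y)(w,τ)‖ ≤
# ‖Q̄_{W̃}(g·Y)(w,τ)‖` when `U′ = W̃` on the level box of every coarse bond whose box meets `{g ≠ 0}` (F265's locality; zero boxes by linearity at `U′`)

Cell `pub-balaban`, rung (B)+1 sub-cell t4, lineage `b2b-balaban-t4-ne7-p1` (CRUX PROVER NE7 #1 = OWNER of row NE7), generation 89; memo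
`t4/b2b-balaban-t4-ne7-p1-g89/COSTING-N1.md` §7 ((N2)-straight, bricks (a), B2, B3′).  File F267 (over F48b `NE7ExpansionRemainderFlat.abs_dAction_vary_sub_hess_flat_le` (EXP),
`NE7ExpansionSegmentLetters` (`sum_perWin_bondL1At_le`, `norm_curlAt_flat_le`, `smallField_flat_zero`), F38 `NE7ApeFlatSkeleton.hess_flat`, F247 `NE7FirstVariationLocality`
(`curlAt_congr_of_agree`, `fhol_congr_of_agree`), F265 `NE7QbarLocality` (`QbarIter_congr₂ ∕ QbarIter_congr ∕ agreeOn_level_of_slab`), row NE3's `QbarIter_smul`).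

WHY (memo §7).  The v4 END (F263) hypothesises, per plaquette, `|dAction_{e^A} Y| ≤ τn‖Y‖_{near} + τf‖Y‖_{far}` on straight tangents.  The assembly (next file) writes
`Y = χ′Y + (1−χ′)Y`: the outer piece is paid by the sup density (a) on the far region; the inner piece is moved to the tangent-critical `U′` by (b), paired through
criticality (F264: `≤ c_R‖Q̄_{U′}(χ′Y)‖₁`), moved back to the global `e^{A}` background by (c), and split into the Lipschitz budget (F51) plus the shell term (F266).
WHAT ([folklore]; 0 def, 0 sorry; generic `d`).
§1 `norm_curl_flat_le_bondL1At`, **`abs_hess_flat_le_dirL1`** (`|hess 1 A Y (perWin)| ≤ 4·#Plane·α₁·‖Y‖_{ℓ¹(periodBox)}`), **`abs_dAction_vary_flat_le_dirL1`**.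
§2 `curl_weight_eq_zero`, **`dAction_weight_congr`**.
§3 `QbarIter_dir_zero`, **`norm_QbarIter_weight_le_of_agree`**.
HONEST FRAMING (page 1): bookkeeping letters; nothing of Bałaban's asserted; NOT (APE), NOT ONE-STEP, NOT NE7; spine 0∕9; finite T⁴ rung (B)+1 — NOT infinite volume, NOT
mass gap, NOT `BetaPertH`, NOT Clay.  Continuum YM on T⁴ ⇐ BetaPertH ∧ nine spine estimates (0/9 proved); BetaPertH ⇐ (D1) ∧ (D4) ∧ CAP+tail; G-an2-4 gates asym, D1
and NE2/3/4.
-/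

set_option autoImplicit false

open scoped BigOperators Matrix.Norms.L2Operator
open NormedSpace Finset Set

namespace Summit.QuantumFields.BalabanUV.T4Continuum.NE7StraightDefectLetters

open Literature.MathematicalPhysics.QuantumFieldTheory.Balaban1983to89
open B7Prop1Explicit B7Prop2Explicit MatrixLog UnitaryModel
open B7Prop1Local (InBox AgreeOn loK bondHiK)
open T4AveragingDeficitWall (IsUnitaryCfg IsSkewDir SmallField vary curlAt curl fhol Ad dirL1)
open T4AveragingDeficitWallBoundary (periodBox)
open AveragingDeficitPeriodicCounting (IsPeriodicDir)
open AveragingDeficitNearIdentity (abs_nReTr_mul_le)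
open AveragingDeficitMultiLevelPrep (LevelSmall)
open MinimalActionLevels (perWin)
open NE3HessForm (hess dAction)
open NE3HessContinuity (bondL1At bondL1At_nonneg)
open BlockAveragePushDirSplit (flat)
open NE3SmoothLiftCurl (curlAt_flat_eq)
open NE3TangentCovariantTower (QbarIter)
open NE3SmoothRightInverseW (QbarIter_smul)
open NE7ApeFlatSkeleton (hess_flat)
open NE7ExpansionSegmentLetters (sum_perWin_bondL1At_le smallField_flat_zero norm_curlAt_flat_le)
open NE7ExpansionRemainderFlat (abs_dAction_vary_sub_hess_flat_le)
open NE7FirstVariationLocality (curlAt_congr_of_agree fhol_congr_of_agree)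
open NE7QbarLocality (QbarIter_congr₂ QbarIter_congr agreeOn_level_of_slab)
open NE3LinearisedAverageLocality (agreeOn_self)

noncomputable section

variable {d : ℕ} {n : Type*} [Fintype n] [DecidableEq n]

/-! ## §1 The sup density of the first variation at `e^{A}` -/

/-- `‖(d_1 Y)(p)‖ ≤ bl₁(Y)(p)`: the flat curl is a signed sum of the four bond values. [folklore] -/
theorem norm_curl_flat_le_bondL1At (Y : Site d → Fin d → Matrix n n ℂ) (z : Site d) (μ ν : Fin d) :
    ‖curlAt (flat (d := d) (n := n)) Y z μ ν‖ ≤ bondL1At Y z μ ν := by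
  rw [curlAt_flat_eq]
  unfold bondL1At
  calc ‖(Y (z + e μ) ν - Y z ν) - (Y (z + e ν) μ - Y z μ)‖ ≤ ‖Y (z + e μ) ν - Y z ν‖ + ‖Y (z + e ν) μ - Y z μ‖ := norm_sub_le _ _
    _ ≤ (‖Y (z + e μ) ν‖ + ‖Y z ν‖) + (‖Y (z + e ν) μ‖ + ‖Y z μ‖) := add_le_add (norm_sub_le _ _) (norm_sub_le _ _)
    _ = _ := by ring

/-- **`|hess 1 A Y (perWin d P)| ≤ 4·#Plane·α₁·‖Y‖_{ℓ¹(periodBox P)}`** for a `P`-periodic `Y` and any `A` with lattice differences `≤ α₁`: the flat Hessian is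
`−Σ_p Re tr[(d_1Y)(p)(d_1A)(p)]∕N` (F38), `‖d_1A‖ ≤ 2α₁`, `‖d_1Y(p)‖ ≤ bl₁(Y)(p)`, and the window sum of `bl₁` is `≤ 2#Plane‖Y‖₁`. [folklore] -/
theorem abs_hess_flat_le_dirL1 [Nonempty n] {P : ℕ} (hP : 1 ≤ P) {A : Site d → Fin d → Matrix n n ℂ} {α₁ : ℝ} (hα₁ : 0 ≤ α₁)
    (hA1 : ∀ (y : Site d) (κ τ : Fin d), ‖A (y + e τ) κ - A y κ‖ ≤ α₁)
    {Y : Site d → Fin d → Matrix n n ℂ} (hYP : IsPeriodicDir Y (P : ℤ)) :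
    |hess (flat (d := d) (n := n)) A Y (perWin d P)| ≤ 4 * (Fintype.card (T4AveragingDeficitWall.Plane d) : ℝ) * α₁ * dirL1 Y (periodBox (d := d) P) := by
  classical
  rw [hess_flat (smallField_flat_zero (d := d) (n := n)), abs_neg]
  refine (Finset.abs_sum_le_sum_abs _ _).trans ?_
  have hterm : ∀ p ∈ perWin d P, |nReTr (curl (flat (d := d) (n := n)) Y p * curl (flat (d := d) (n := n)) A p)|
      ≤ 2 * α₁ * bondL1At Y p.1 p.2.1.1 p.2.1.2 := by
    intro p _
    refine (abs_nReTr_mul_le _ _).trans ?_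
    have hA := norm_curlAt_flat_le (d := d) (n := n) hA1 p.1 p.2.1.1 p.2.1.2
    have hY := norm_curl_flat_le_bondL1At (d := d) (n := n) Y p.1 p.2.1.1 p.2.1.2
    have hb := bondL1At_nonneg Y p.1 p.2.1.1 p.2.1.2
    calc ‖curl (flat (d := d) (n := n)) Y p‖ * ‖curl (flat (d := d) (n := n)) A p‖ ≤ bondL1At Y p.1 p.2.1.1 p.2.1.2 * (2 * α₁) :=
          mul_le_mul hY hA (norm_nonneg _) hb
      _ = _ := by ring
  calc ∑ p ∈ perWin d P, |nReTr (curl (flat (d := d) (n := n)) Y p * curl (flat (d := d) (n := n)) A p)|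
      ≤ ∑ p ∈ perWin d P, 2 * α₁ * bondL1At Y p.1 p.2.1.1 p.2.1.2 := Finset.sum_le_sum hterm
    _ = 2 * α₁ * ∑ p ∈ perWin d P, bondL1At Y p.1 p.2.1.1 p.2.1.2 := by rw [Finset.mul_sum]
    _ ≤ 2 * α₁ * (2 * (Fintype.card (T4AveragingDeficitWall.Plane d) : ℝ) * dirL1 Y (periodBox (d := d) P)) :=
        mul_le_mul_of_nonneg_left (sum_perWin_bondL1At_le hP hYP) (by positivity)
    _ = _ := by ring

/-- **THE SUP DENSITY OF THE FIRST VARIATION AT `e^{A}`**: for `A` skew `P`-periodic with `‖A‖ ≤ α₀` and lattice differences `≤ α₁`, every skew `P`-periodic `Y` has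
`|dAction (e^{A}) Y (perWin d P)| ≤ (ρ(α₀,α₁) + 4·#Plane·α₁)·‖Y‖_{ℓ¹(periodBox P)}`, `ρ` = F48b's EXP density. [folklore] -/
theorem abs_dAction_vary_flat_le_dirL1 [Nonempty n] {P : ℕ} (hP : 1 ≤ P) {A : Site d → Fin d → Matrix n n ℂ} (hA : IsSkewDir A)
    (hAP : IsPeriodicDir A (P : ℤ)) {α₀ α₁ : ℝ} (hα₀ : 0 ≤ α₀) (hα₁ : 0 ≤ α₁)
    (hAα : ∀ y κ, ‖A y κ‖ ≤ α₀) (hA1 : ∀ (y : Site d) (κ τ : Fin d), ‖A (y + e τ) κ - A y κ‖ ≤ α₁)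
    {Y : Site d → Fin d → Matrix n n ℂ} (hY : IsSkewDir Y) (hYP : IsPeriodicDir Y (P : ℤ)) :
    |dAction (vary (flat (d := d) (n := n)) A 1) Y (perWin d P)|
      ≤ ((Fintype.card (T4AveragingDeficitWall.Plane d) : ℝ)
            * (2 * (8 * α₀ * (2 * α₁ + 28 * α₀ ^ 2) + 6 * (Real.exp α₀ - 1) * (2 * α₁ + 24 * (Real.exp α₀ - 1) * α₀)
                + (2 * α₁ + 24 * (Real.exp α₀ - 1) * α₀) * (2 * α₁ + 28 * α₀ ^ 2) + 960 * (Real.exp α₀ - 1) * α₀ ^ 2)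
              + 64 * α₀ * α₁)
          + 4 * (Fintype.card (T4AveragingDeficitWall.Plane d) : ℝ) * α₁) * dirL1 Y (periodBox (d := d) P) := by
  have h1 := abs_dAction_vary_sub_hess_flat_le hP hA hAP hα₀ hα₁ hAα hA1 hY hYP
  have h2 := abs_hess_flat_le_dirL1 (d := d) (n := n) hP hα₁ hA1 hYP
  have h3 := abs_sub_abs_le_abs_sub (dAction (vary (flat (d := d) (n := n)) A 1) Y (perWin d P)) (hess (flat (d := d) (n := n)) A Y (perWin d P))
  rw [add_mul]
  linarith

/-! ## §2 Weighted configuration locality of the first variation -/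

/-- At a plaquette whose three base corners `z, z+e_μ, z+e_ν` carry `g = 0`, the covariant curl of `g·Y` vanishes (for ANY configuration). [folklore] -/
theorem curl_weight_eq_zero (V : Site d → Fin d → (Matrix n n ℂ)ˣ) (g : Site d → ℝ) (Y : Site d → Fin d → Matrix n n ℂ) {z : Site d} {μ ν : Fin d}
    (hz : g z = 0) (hμ : g (z + e μ) = 0) (hν : g (z + e ν) = 0) :
    curlAt V (fun (x : Site d) (κ : Fin d) => g x • Y x κ) z μ ν = 0 := by
  unfold curlAt Ad
  simp only [hz, hμ, hν, zero_smul, mul_zero, zero_mul, add_zero, sub_self]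

/-- **`dAction V (g·Y) W = dAction V′ (g·Y) W`** whenever `V, V′` agree on the four bonds of every plaquette `(z; μ,ν) ∈ W` at one of whose base corners `z, z+e_μ, z+e_ν`
the weight `g` does not vanish (at the other plaquettes both densities vanish: the direction `g·Y` is zero on all four bonds). [folklore] -/
theorem dAction_weight_congr {V V' : Site d → Fin d → (Matrix n n ℂ)ˣ} (g : Site d → ℝ) (Y : Site d → Fin d → Matrix n n ℂ)
    (W : Finset (T4AveragingDeficitWall.Plaq d))
    (hV : ∀ (z : Site d) (μ ν : Fin d), (g z ≠ 0 ∨ g (z + e μ) ≠ 0 ∨ g (z + e ν) ≠ 0) →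
      V z μ = V' z μ ∧ V (z + e μ) ν = V' (z + e μ) ν ∧ V (z + e ν) μ = V' (z + e ν) μ ∧ V z ν = V' z ν) :
    dAction V (fun (x : Site d) (κ : Fin d) => g x • Y x κ) W = dAction V' (fun (x : Site d) (κ : Fin d) => g x • Y x κ) W := by
  unfold dAction
  refine congrArg Neg.neg (Finset.sum_congr rfl fun p _ => ?_)
  by_cases h : g p.1 ≠ 0 ∨ g (p.1 + e p.2.1.1) ≠ 0 ∨ g (p.1 + e p.2.1.2) ≠ 0
  · obtain ⟨h1, h2, h3, h4⟩ := hV p.1 p.2.1.1 p.2.1.2 h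
    have hc : curl V (fun (x : Site d) (κ : Fin d) => g x • Y x κ) p = curl V' (fun (x : Site d) (κ : Fin d) => g x • Y x κ) p :=
      curlAt_congr_of_agree h1 h2 h3 rfl rfl rfl rfl
    have hf : fhol V p = fhol V' p := fhol_congr_of_agree h1 h2 h3 h4
    rw [hc, hf]
  · push Not at h
    obtain ⟨hz, hμ, hν⟩ := h
    have h0 : curl V (fun (x : Site d) (κ : Fin d) => g x • Y x κ) p = 0 := curl_weight_eq_zero V g Y hz hμ hν
    have h0' : curl V' (fun (x : Site d) (κ : Fin d) => g x • Y x κ) p = 0 := curl_weight_eq_zero V' g Y hz hμ hν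
    rw [h0, h0', zero_mul, zero_mul]

/-! ## §3 The pointwise comparison of the double-bar averages of a weighted direction at two backgrounds -/

/-- `Q̄^{(k+1)}_W 0 = 0` for a background of the multi-level class (linearity, row NE3's `QbarIter_smul` at `c = 0`). [folklore] -/
theorem QbarIter_dir_zero [Nonempty n] {L : ℕ} (hL : 1 ≤ L) (k : ℕ) {W : Site d → Fin d → (Matrix n n ℂ)ˣ} {x : ℝ} (hWu : IsUnitaryCfg W) (hx : 0 ≤ x)
    (hs : LevelSmall d L k x) (hWx : SmallField W x) :
    QbarIter L (k + 1) W (0 : Site d → Fin d → Matrix n n ℂ) = 0 := by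
  have h := QbarIter_smul hL k hWu hx hs hWx 0 (0 : Site d → Fin d → Matrix n n ℂ)
  simp only [zero_smul] at h
  exact h

/-- **`‖Q̄_{U′}(g·Y)(w,τ)‖ ≤ ‖Q̄_{W̃}(g·Y)(w,τ)‖`** at every coarse bond `(w,τ)`, for `U′` of the multi-level class and ANY `W̃`, provided `U′ = W̃` on every bond based in
the level slab `L^{k+1}w_i ≤ x_i ≤ L^{k+1}w_i + 2L^{k+1} − 1` WHENEVER the weight `g` does not vanish identically on that slab (then the two sides are EQUAL by F265's
locality; otherwise the left side is `Q̄_{U′}0 = 0`). [folklore] -/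
theorem norm_QbarIter_weight_le_of_agree [Nonempty n] {L : ℕ} (hL : 1 ≤ L) (k : ℕ) {U' Wt : Site d → Fin d → (Matrix n n ℂ)ˣ} {x : ℝ}
    (hU'u : IsUnitaryCfg U') (hx : 0 ≤ x) (hs : LevelSmall d L k x) (hU'x : SmallField U' x)
    (g : Site d → ℝ) (Y : Site d → Fin d → Matrix n n ℂ) (w : Site d) (τ : Fin d)
    (hagree : (∃ x₀ : Site d, (∀ i, (L : ℤ) ^ (k + 1) * w i ≤ x₀ i ∧ x₀ i ≤ (L : ℤ) ^ (k + 1) * w i + 2 * (L : ℤ) ^ (k + 1) - 1) ∧ g x₀ ≠ 0) →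
      ∀ (x : Site d) (μ : Fin d), (∀ i, (L : ℤ) ^ (k + 1) * w i ≤ x i ∧ x i ≤ (L : ℤ) ^ (k + 1) * w i + 2 * (L : ℤ) ^ (k + 1) - 1) → U' x μ = Wt x μ) :
    ‖QbarIter L (k + 1) U' (fun (x : Site d) (κ : Fin d) => g x • Y x κ) w τ‖
      ≤ ‖QbarIter L (k + 1) Wt (fun (x : Site d) (κ : Fin d) => g x • Y x κ) w τ‖ := by
  by_cases h : ∃ x₀ : Site d, (∀ i, (L : ℤ) ^ (k + 1) * w i ≤ x₀ i ∧ x₀ i ≤ (L : ℤ) ^ (k + 1) * w i + 2 * (L : ℤ) ^ (k + 1) - 1) ∧ g x₀ ≠ 0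
  · -- the backgrounds agree on the level box: equality
    rw [QbarIter_congr₂ hL (k + 1) w τ (agreeOn_level_of_slab L (k + 1) w τ (hagree h)) (agreeOn_self _ _ _)]
  · -- the weight vanishes on the level box: the left side is `Q̄_{U′} 0 = 0`
    push Not at h
    have hX : AgreeOn (loK L (k + 1) w) (bondHiK L (k + 1) w τ) (fun (x : Site d) (κ : Fin d) => g x • Y x κ) (0 : Site d → Fin d → Matrix n n ℂ) :=
      agreeOn_level_of_slab L (k + 1) w τ fun x μ hx => by simp only [h x hx, zero_smul, Pi.zero_apply]
    rw [QbarIter_congr hL (k + 1) U' w τ hX, QbarIter_dir_zero hL k hU'u hx hs hU'x]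
    simp only [Pi.zero_apply, norm_zero]
    exact norm_nonneg _

end

end Summit.QuantumFields.BalabanUV.T4Continuum.NE7StraightDefectLetters
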